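import Literature.MathematicalPhysics.QuantumFieldTheory.Balaban1983to89.B9Prop26AtPinsOne
import Literature.MathematicalPhysics.QuantumFieldTheory.Balaban1983to89.B9Eq3132FlatReadingAtOne
import Literature.MathematicalPhysics.QuantumFieldTheory.Balaban1983to89.Node00.OpsYSectDCoords
import Literature.MathematicalPhysics.QuantumFieldTheory.Balaban1983to89.B9Thm312WholeH

/-!
# `Balaban1983to89.B9LettersHCOneObstruction` — [B9] (3.132) ∕ (3.126) AT `U = 1`: the C-LETTER `c2` of Theorem 3.12's reduction schema
# `B9Thm312WholeH.LettersH`, pinned to node00-def-Y's FLAT coordinate model `CcoK` of `C = (QGQ*)⁻¹`, has NO MEMBER-UNIFORM MAJORANT EVEN AT THE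
# TRIVIAL BACKGROUND — a LOCATED UNITS DEFECT (dag-n06-i's row-26 mechanism: Kantorovich + [4] (2.142)) biting the N06 certificate's `hlettersH12`

T. Bałaban, *Propagators for lattice gauge theories in a background field*, Commun. Math. Phys. **99** (1985) 389–434
[`Balaban1985BackgroundPropagators`, "B9"]; [4] = T. Bałaban, *Propagators and renormalization transformations for lattice gauge
theories. II*, Commun. Math. Phys. **96** (1984) 223–250 [`Balaban1984PropagatorsII`].

statement-level skeleton of published theorems with citation tags; proofs where landed; nothing here is a claim about the Yang–Mills
mass gap

THE PRINT.  [B9] p. 422: *"|(QGQ\*)⁻¹(y, y′)| ≦ O(1)(Lʲη)⁻²(L^{j′}η)^{−d}e^{−δ₁d(y,y′)} for y ∈ Λ_j, y′ ∈ Λ_{j′}, (3.132)"* — a KERNEL w.r.t. the η-lattice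
pairings; [4] p. 228: *"QGQ\* is positive … an inverse is a well-defined and positive operator"*; [4] (2.142) p. 248 (the flat entries of `QGQ*`, PROVED
in the tree: `B6Ineq2142KLevelV1.ineq2142_kLevel`).

THE TYPED OBJECTS.  dag-n06-l's schema `B9Thm312WholeH.LettersH 𝔬 R₀ H₀ hG B₃ δ₃ U`, field `c2 : HasMaj (cNorm R₀ H₀ 𝔬.blkZ hG.lenle 2) (cNorm R₀ H₀
𝔬.blkZ hG.lenle 0) (𝔬.C U) (fun a b => B₃·e^{−δ₃d(a,b)})` (*"(3.132) in the transferred classes Z² → Z⁰"*: size of `Cω` near `y` ≦ `B₃e^{−δ₃d}·(L^{j′}η)⁻²·`size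
of `ω` near `y′`); the N06 certificate (dag-n06-d, editions ≤ 19) displays `hlettersH12 : ∀ x, M12 ≤ M → ∀ α₀ > 0, Mα₀ ≤ a12 → ∀ U ∈ (3.35)∩(3.36),
LettersH (𝔬12 x) 1 (H x) … B12₃ δ12₃ U` with ONE `B12₃` for the family, and PINS `(𝔬12 x).C U` to node00-def-Y's `Node00.OpsYSectDCoords.CcoK … U =
cR39 b • coordOpK b (fun _ => (QGQ*)⁻¹(U))` (`hCco12`), `(𝔬12 x).blkZ = blkHK` (`hblkZ12`) — the FLAT real-coordinate model of the letter `QGQinvY`.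

THE DEFECT (mechanism = dag-n06-i's `B9Eq3132FlatReadingAtOne.not_stmt3132Printed_flat_of_one`, row 26, transplanted).  At `U = 1` the letter is
[4]'s: `QGQinvY … 1 = (onFun EE)♯` (`B9Eq3132SectDLetters.QGQinvY_one_liftEndY`), `EE = (QGQ*)⁻¹` of r03's FLAT-basis model (`Q*` = the flat transpose of
the block AVERAGE).  By `B9Prop26AtPinsOne.coordOpK_apply_of_liftY` the pinned model acts slice by slice, so on the indicator of one carrier point over the
index bond `b`: `(CcoK … U₁ 𝟙)(that point) = cR39 b · ⟪e_b, EE e_b⟫` (§1).  Kantorovich and the diagonal case of (2.142) give `⟪e_b, EE e_b⟫ ≥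
L^{j(b)D}∕(A′·len(b)²)` (dag-n06-i `one_le_wt_mul_inner_EE`, `Λ_b² = len(b)²·L^{−jD}`, `D = d + 1`), while `c2` at source = target block `b` reads
`cR39·⟪e_b, EE e_b⟫ ≤ B₃·len(b)⁻²·1` (§2) — so `B₃ ≥ (cR39∕A′)·L^{j(b)D}`: the `len(b)²` CANCEL (no re-weighting of the classes repairs it).  The top-empty
members of `Node00.kRIdx_nonvacuous_oddL` (every nominal `k ≥ 2` beyond every threshold; an index bond of level `k − 1`, n06-i `exists_bondIdx_lvl_eq`) force
`B₃ ≥ (cR39∕A′)·L^{(k−1)D}` for every `k`: NO member-uniform `B₃` (§3).  Hence the displayed `hlettersH12` is FALSE for every value of its numerics (`a12 > 0`):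
editions pinning `C` flat are vacuous as typed (§4) — exactly as row 26 was before its ν-repair.  (`gQs2 ∕ dgQs` of the same schema are fine and PROVED at
`U = 1`, `B9LettersHAtOneG0`: `G₀Q*` carries the averaging weights `q ≦ L^{−j′D}`; `(QGQ*)⁻¹` alone carries `L^{+jD}`; `H = G₀Q*C` is convention-free.)

THE REPAIR (owners named, not chosen here).  (R1) node00-def-Y reads `C ∕ C₁` through a Λ-WEIGHTED model (`Λ_b = B6Prop27KLevelV1.lam`, as row 26's
ν-reading) and dag-n06-l's `c2 ∕ c12 ∕ c1_*` take the matching classes; or (R2) dag-n06-l folds `C` into `H = G₀Q*C` ∕ `H₁` ([4] Cor. 2.8, in the tree: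
`B6Cor28HolderUnifKLevelV1.cor28Printed_kLevel`) and drops the separate C-letters.

HONEST SCOPE.  A NEGATIVE about the TYPED schema × pin combination at `U = 1` (member-uniformity); [4]-at-`U = 1` linear algebra, all PROVED in the
tree ((2.142), positivity of `QGQ*`, the member witnesses) plus bookkeeping; nothing of [B9] is asserted.  COUNT-NEUTRAL; N06 NOT discharged (its rows
20–21 are now KNOWN to need the C-letters re-typed); one finite lattice at a time; nothing continuum, nothing about the mass gap.  Cell `pub-ymgap` (HUMAN
RULING D-0062), Track A node N06 [B9], bundle F3 (the `U = 1` obligations), seat `pub-ymgap-dag-n06-h` (g19), 2026-08-27.  A NEW file; nothing landed is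
modified.
-/

noncomputable section

namespace Literature.MathematicalPhysics.QuantumFieldTheory.Balaban1983to89.B9LettersHCOneObstruction

open scoped InnerProductSpace
open B6MultiLevelBoxOperator (N0)
open B6MultiLevelTorusOperator (TDomains)
open B6KLevelCensusIndexV1 (KIdx)
open B6SectAOperatorsV1 (BondIdx BondIdxSpace)
open B6SectAVectorModelV1 (EE inner_EE_pos)
open B6Ineq2142KLevelV1 (lvl β X)
open B6Prop27KLevelV1 (wt_pos)
open B6GlobalChartV1 (PV domT toBox boxEquiv boxEquiv_apply)
open B6Ineq2133TwoScaleV1 (onFun onFun_apply)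
open B9Eq3132FlatReadingAtOne (one_le_wt_mul_inner_EE exists_bondIdx_lvl_eq)
open B9Eq3132SectDLetters (QGQinvY)
open B9PinMembersKLevelV1 (MemberY geo9Y bg9Y)
open B9Thm39ReadingCoords (cR39 cR39_nonneg)
open B9CoReadingCoords B9CoReadingCoordsH B9Prop26AtPinsOne
open B9Thm312Whole (cNorm wt GeoOK Ops)
open B9Thm312WholeH (LettersH)
open B11SectG (HasMaj)
open Node00 Node00.OpsYSectDCoords

variable {d ℓ : ℕ} {hd : 1 ≤ d + 1} {hL : Odd (ℓ + 1) ∧ 1 < ℓ + 1} {b₀ b₁ : ℝ}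

/-! ## §1 The pinned flat model of `(QGQ*)⁻¹` at a configuration reading `1`, on the indicator of one carrier point -/

section Eval

variable {𝔸 : Type} [NormedRing 𝔸] [NormedAlgebra ℂ 𝔸] [CompleteSpace 𝔸] [FiniteDimensional ℝ 𝔸]
variable {κ : Type} [Fintype κ] [DecidableEq κ]
variable (i : KIdx d ℓ hd hL b₀ b₁) (b : Module.Basis κ ℝ 𝔸) (B : B9.Backgrounds) (cfg : B.Cfg → CfgY 𝔸 i)
  (parS : SiteParY 𝔸 i) (parB : BondParY 𝔸 i) (Gp : SiteOpY 𝔸 i)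

omit [Fintype κ] [DecidableEq κ] in
/-- a flat entry of `onFun S` IS the inner product `⟪e_a, S e_{a′}⟫` (the (2.35) operator read in flat coordinates). [cite: Balaban1984PropagatorsII, (2.35) p.228, dictionary] -/
theorem onFun_single_apply {ι : Type} [Fintype ι] [DecidableEq ι] (S : EuclideanSpace ℝ ι →ₗ[ℝ] EuclideanSpace ℝ ι) (a a' : ι) :
    onFun S (Pi.single a' (1 : ℝ)) a = ⟪EuclideanSpace.single a (1 : ℝ), S (EuclideanSpace.single a' (1 : ℝ))⟫_ℝ := by
  rw [← LinearMap.toMatrix'_apply, LinearMap.toMatrix'_apply, EuclideanSpace.inner_single_left, onFun_apply]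
  simp only [map_one, one_mul]
  rfl

omit [DecidableEq κ] in
/-- ★ **THE PINNED FLAT MODEL OF `C = (QGQ*)⁻¹` AT `U = 1`, EVALUATED**: at a configuration `U₁` reading `1`, with the letter's `U = 1` value `(onFun EE)♯`
(`B9Eq3132SectDLetters.QGQinvY_one_liftEndY` at letters with the `U = 1` clauses), node00-def-Y's `CcoK … U₁` acts slice by slice
(`B9Prop26AtPinsOne.coordOpK_apply_of_liftY`): `(CcoK … U₁ f)(a, ν, c, c′) = cR39 b · ((QGQ*)⁻¹ f(·, ν, c, c′))(a)`.
[cite: Balaban1985BackgroundPropagators, (3.123) p.420, (3.132) p.422, Cor. 3.5 p.407; Balaban1984PropagatorsII, (2.35) p.228] -/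
theorem CcoK_one_apply {U₁ : B.Cfg} (hU₁ : cfg U₁ = fun _ _ => 1)
    (hC1 : QGQinvY i parS parB Gp (fun _ _ => 1) = liftEndY 𝔸 (onFun (EE (domT i.hN i.D i.hk) i.hcf i.hw)))
    (f : XHK κ i → ℝ) (p : XHK κ i) :
    CcoK i b B cfg parS parB Gp U₁ f p = cR39 b * onFun (EE (domT i.hN i.D i.hk) i.hcf i.hw) (fun z => f (z, p.2.1, p.2.2.1, p.2.2.2)) p.1 := by
  have hO : ∀ (_ν : Fin (d + 1)) (g : IBondY i → ℝ) (E : 𝔸),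
      ((QGQinvY i parS parB Gp (cfg U₁)).restrictScalars ℝ) (liftY g E) = liftY (onFun (EE (domT i.hN i.D i.hk) i.hcf i.hw) g) E := by
    intro _ g E
    rw [LinearMap.restrictScalars_apply, hU₁, hC1, liftEndY_liftY]
  rw [CcoK, LinearMap.smul_apply, Pi.smul_apply, smul_eq_mul,
    coordOpK_apply_of_liftY b (O := fun _ : Fin (d + 1) => (QGQinvY i parS parB Gp (cfg U₁)).restrictScalars ℝ) hO]

/-- ★ … hence on the INDICATOR of the carrier point `(a, s)` the model returns, at that point, `cR39 b · ⟪e_a, (QGQ*)⁻¹ e_a⟫` — the flat diagonal entry.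
[cite: Balaban1985BackgroundPropagators, (3.132) p.422, Cor. 3.5 p.407; Balaban1984PropagatorsII, (2.35) p.228] -/
theorem CcoK_one_indicator_apply {U₁ : B.Cfg} (hU₁ : cfg U₁ = fun _ _ => 1)
    (hC1 : QGQinvY i parS parB Gp (fun _ _ => 1) = liftEndY 𝔸 (onFun (EE (domT i.hN i.D i.hk) i.hcf i.hw)))
    (a : IBondY i) (s : Fin (d + 1) × κ × κ) :
    CcoK i b B cfg parS parB Gp U₁ (Pi.single (a, s) (1 : ℝ)) (a, s) =
      cR39 b * ⟪EuclideanSpace.single a (1 : ℝ), EE (domT i.hN i.D i.hk) i.hcf i.hw (EuclideanSpace.single a (1 : ℝ))⟫_ℝ := by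
  rw [CcoK_one_apply i b B cfg parS parB Gp hU₁ hC1]
  have hslice : (fun z : IBondY i => (Pi.single (a, s) (1 : ℝ) : XHK κ i → ℝ) (z, s.1, s.2.1, s.2.2)) = Pi.single a (1 : ℝ) := by
    funext z
    by_cases hz : z = a
    · subst hz; simp
    · have hne : ((z, s.1, s.2.1, s.2.2) : XHK κ i) ≠ (a, s) := fun h => hz (congrArg Prod.fst h)
      rw [Pi.single_eq_of_ne hne, Pi.single_eq_of_ne hz]
  rw [hslice, onFun_single_apply]

end Eval

/-! ## §2 What the schema `c2` says at `U = 1` at the flat pin: `cR39 · ⟪e_b, (QGQ*)⁻¹ e_b⟫ ≤ B₃` at EVERY index bond -/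

section Schema

variable {𝔸 : Type} [NormedRing 𝔸] [NormedAlgebra ℂ 𝔸] [CompleteSpace 𝔸] [FiniteDimensional ℝ 𝔸]
variable {κ : Type} [Fintype κ] [DecidableEq κ]
variable (i : KIdx d ℓ hd hL b₀ b₁) (b : Module.Basis κ ℝ 𝔸) (B : B9.Backgrounds) (cfg : B.Cfg → CfgY 𝔸 i)
  (parS : SiteParY 𝔸 i) (parB : BondParY 𝔸 i) (Gp : SiteOpY 𝔸 i)

/-- ★★ **THE SCHEMA `c2` AT THE FLAT PIN, AT `U = 1`, FORCES `cR39·⟪e_b, (QGQ*)⁻¹e_b⟫ ≤ B₃·len(b)⁻²` AT EVERY INDEX BOND** (test vector: the indicator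
of one carrier point over `b`; source block = target block = `b`, distance `0`; the source class weight `len(b)⁻²` times the unit size of the indicator,
the target weight `1`).
[cite: Balaban1985BackgroundPropagators, (3.132) p.422, p.398 (remark after (3.47)); Balaban1984PropagatorsII, (2.35) p.228, (2.51) p.232] -/
theorem inner_EE_le_of_hasMaj_c2_one [Fintype (B9GeoNormsKLevelV1.geo9K i).Site] {U₁ : B.Cfg} (hU₁ : cfg U₁ = fun _ _ => 1)
    (hC1 : QGQinvY i parS parB Gp (fun _ _ => 1) = liftEndY 𝔸 (onFun (EE (domT i.hN i.D i.hk) i.hcf i.hw)))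
    {R₀ : ℝ} {H₀ : Prop} {hlen : ∀ y : (B9GeoNormsKLevelV1.geo9K i).Site, 0 ≤ (B9GeoNormsKLevelV1.geo9K i).len y} {B₃ δ₃ : ℝ}
    (h : HasMaj (cNorm R₀ H₀ (blkHK (κ := κ) i) hlen 2) (cNorm R₀ H₀ (blkHK (κ := κ) i) hlen 0) (CcoK i b B cfg parS parB Gp U₁)
      (fun a a' => B₃ * Real.exp (-(δ₃ * (B9GeoNormsKLevelV1.geo9K i).dist a a'))))
    (s : Fin (d + 1) × κ × κ) (a : IBondY i) :
    cR39 b * ⟪EuclideanSpace.single a (1 : ℝ), EE (domT i.hN i.D i.hk) i.hcf i.hw (EuclideanSpace.single a (1 : ℝ))⟫_ℝ ≤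
      B₃ * ((B9GeoNormsKLevelV1.geo9K i).len a ^ 2)⁻¹ := by
  classical
  set μ : XHK κ i → ℝ := Pi.single (a, s) (1 : ℝ) with hμ
  have hμoff : ∀ q : XHK κ i, q ≠ (a, s) → μ q = 0 := fun q hq => by rw [hμ, Pi.single_eq_of_ne hq]
  have hμle : ∀ q : XHK κ i, |μ q| ≤ 1 := fun q => by
    by_cases hq : q = (a, s)
    · subst hq; rw [hμ]; simp
    · rw [hμoff q hq, abs_zero]; exact zero_le_one
  -- `μ` is localised at the block `a`, with sharp-block size exactly `1`
  have hloc : (cNorm R₀ H₀ (blkHK (κ := κ) i) hlen 2).IsLoc a μ := fun q hq =>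
    hμoff q fun h => hq (by rw [h]; rfl)
  have hsupp : B6RandomWalk.BlockSupp (g := B9Thm34Ext.toB6 (B9GeoNormsKLevelV1.geo9K i) R₀ H₀) (blkHK (κ := κ) i) μ a 1 :=
    ⟨zero_le_one, fun q _ => hμle q, fun q hq => hμoff q fun h => hq (by rw [h]; rfl)⟩
  have hone : (B11SectG.BlockNorm.ofBlocks (B9Thm34Ext.toB6 (B9GeoNormsKLevelV1.geo9K i) R₀ H₀) (blkHK (κ := κ) i)).loc a μ = 1 := by
    refine le_antisymm (B9Thm37AllNormsInstances.ofBlocks_loc_le_of_blockSupp _ hsupp) ?_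
    have h1 := B9Thm37AllNormsInstances.abs_apply_le_ofBlocks_loc (G := B9Thm34Ext.toB6 (B9GeoNormsKLevelV1.geo9K i) R₀ H₀)
      (blkHK (κ := κ) i) a μ (a, s) rfl
    rw [hμ] at h1 ⊢
    simpa using h1
  have hsrc : (cNorm R₀ H₀ (blkHK (κ := κ) i) hlen 2).loc a μ = ((B9GeoNormsKLevelV1.geo9K i).len a ^ 2)⁻¹ := by
    show wt (B9GeoNormsKLevelV1.geo9K i) 2 a *
        (B11SectG.BlockNorm.ofBlocks (B9Thm34Ext.toB6 (B9GeoNormsKLevelV1.geo9K i) R₀ H₀) (blkHK (κ := κ) i)).loc a μ = _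
    rw [hone, mul_one]; rfl
  -- the target size dominates the value at the point `(a, s)`
  have hval := CcoK_one_indicator_apply i b B cfg parS parB Gp hU₁ hC1 a s
  have htgt : cR39 b * ⟪EuclideanSpace.single a (1 : ℝ), EE (domT i.hN i.D i.hk) i.hcf i.hw (EuclideanSpace.single a (1 : ℝ))⟫_ℝ ≤
      (cNorm R₀ H₀ (blkHK (κ := κ) i) hlen 0).loc a (CcoK i b B cfg parS parB Gp U₁ μ) := by
    show _ ≤ wt (B9GeoNormsKLevelV1.geo9K i) 0 a *
        (B11SectG.BlockNorm.ofBlocks (B9Thm34Ext.toB6 (B9GeoNormsKLevelV1.geo9K i) R₀ H₀) (blkHK (κ := κ) i)).loc a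
          (CcoK i b B cfg parS parB Gp U₁ μ)
    have hwt0 : wt (B9GeoNormsKLevelV1.geo9K i) 0 a = 1 := by unfold wt; simp
    rw [hwt0, one_mul]
    have h1 := B9Thm37AllNormsInstances.abs_apply_le_ofBlocks_loc (G := B9Thm34Ext.toB6 (B9GeoNormsKLevelV1.geo9K i) R₀ H₀)
      (blkHK (κ := κ) i) a (CcoK i b B cfg parS parB Gp U₁ μ) (a, s) rfl
    rw [hμ] at h1 ⊢
    rw [hval] at h1
    exact (le_abs_self _).trans h1
  -- the displayed kernel at distance `0`
  have hmaj := h a μ hloc a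
  have hdist : (B9GeoNormsKLevelV1.geo9K i).dist a a = 0 := B9GeoLemma21KLevelV1.geo9K_dist_self i a
  have hK : (fun a' a'' => B₃ * Real.exp (-(δ₃ * (B9GeoNormsKLevelV1.geo9K i).dist a' a''))) a a = B₃ := by
    simp only [hdist, mul_zero, neg_zero, Real.exp_zero, mul_one]
  rw [hK, hsrc] at hmaj
  exact htgt.trans hmaj

end Schema

/-! ## §3 No member-uniform majorant: the top-empty members of every nominal index (Kantorovich + [4] (2.142)) -/

section Uniform

variable {𝔸 : Type} [NormedRing 𝔸] [NormedAlgebra ℂ 𝔸] [CompleteSpace 𝔸] [FiniteDimensional ℝ 𝔸]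
variable {κ : Type} [Fintype κ] [DecidableEq κ] {Mstar : ℕ}

/-- ★★★ **THE C-LETTER `c2` AT THE FLAT PIN HAS NO MEMBER-UNIFORM MAJORANT AT `U = 1`**: for every family index with `4 ≤ ℓ` (odd `L ≥ 5`), band
`0 < b₀ ≤ b₁`, floor `M⋆`, every basis `b` with `cR39 b > 0`, every background subgroup `G`, every letter families `parS ∕ parB ∕ Gp` whose `(QGQ*)⁻¹`
at `U = 1` IS [4]'s (`QGQinvY … 1 = (onFun EE)♯` — node00-def-Y's `QGQinvY_one_liftEndY` from the `CovLettersY` clauses), every `R₀ ∕ H₀ ∕ hlen`: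
there are NO `B₃, δ₃, M₁` with `HasMaj (𝔠_Z⁽²⁾) (𝔠_Z⁽⁰⁾) (CcoK … 1) (B₃e^{−δ₃d})` at every member above `M₁`.  WITNESS: a top-empty member of nominal index
`k = n + 2` (`Node00.kRIdx_nonvacuous_oddL`), an index bond `b` of level `n + 1` (dag-n06-i `exists_bondIdx_lvl_eq`): §2 gives `cR39·⟪e_b, EE e_b⟫ ≤
B₃·L²`, Kantorovich + (2.142) (`one_le_wt_mul_inner_EE`, `B6Ineq2142KLevelV1.ineq2142_kLevel`) give `1 ≤ A′·L⁻²·L^{−(d+1)(n+1)}·⟪e_b, EE e_b⟫`, so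
`L^{(d+1)(n+1)} ≤ A′B₃∕cR39` — false once `Lⁿ > A′B₃∕cR39`.
[cite: Balaban1985BackgroundPropagators, (3.132) p.422, (3.126) p.420, Cor. 3.5 p.407; Balaban1984PropagatorsII, (2.35) p.228, (2.142) p.248, Prop. 2.7 (2.149) p.249] -/
theorem not_exists_uniform_c2_CcoK_one (hℓ : 4 ≤ ℓ) (hb₀ : 0 < b₀) (hb₁ : b₀ ≤ b₁) (b𝔸 : Module.Basis κ ℝ 𝔸) (hc : 0 < cR39 b𝔸)
    (G : Subgroup 𝔸ˣ)
    (parS : ∀ x : MemberY d ℓ hd hL b₀ b₁ Mstar, SiteParY 𝔸 x.toKIdx) (parB : ∀ x : MemberY d ℓ hd hL b₀ b₁ Mstar, BondParY 𝔸 x.toKIdx)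
    (Gp : ∀ x : MemberY d ℓ hd hL b₀ b₁ Mstar, SiteOpY 𝔸 x.toKIdx)
    (hC1 : ∀ x : MemberY d ℓ hd hL b₀ b₁ Mstar,
      QGQinvY x.toKIdx (parS x) (parB x) (Gp x) (fun _ _ => 1) = liftEndY 𝔸 (onFun (EE (domT x.hN x.D x.hk) x.hcf x.hw)))
    (R₀ : MemberY d ℓ hd hL b₀ b₁ Mstar → ℝ) (H₀ : MemberY d ℓ hd hL b₀ b₁ Mstar → Prop)
    (hlen : ∀ x : MemberY d ℓ hd hL b₀ b₁ Mstar, ∀ y : (geo9Y x).Site, 0 ≤ (geo9Y x).len y)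
    [∀ x : MemberY d ℓ hd hL b₀ b₁ Mstar, Fintype (geo9Y x).Site] (s : Fin (d + 1) × κ × κ) :
    ¬ ∃ B₃ δ₃ M₁ : ℝ, ∀ x : MemberY d ℓ hd hL b₀ b₁ Mstar, M₁ ≤ (geo9Y x).M →
      HasMaj (cNorm (R₀ x) (H₀ x) (blkHK (κ := κ) x.toKIdx) (hlen x) 2) (cNorm (R₀ x) (H₀ x) (blkHK (κ := κ) x.toKIdx) (hlen x) 0)
        (CcoK x.toKIdx b𝔸 (bg9Y 𝔸 G x) (fun U => U) (parS x) (parB x) (Gp x) (fun _ _ => 1))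
        (fun a a' => B₃ * Real.exp (-(δ₃ * (geo9Y x).dist a a'))) := by
  rintro ⟨B₃, δ₃, M₁, H⟩
  -- the constants of [4] (2.142) at this `(d, L, band)`
  obtain ⟨σ₁, hσ₁, h42⟩ := B6Ineq2142KLevelV1.ineq2142_kLevel d ℓ hd hL hb₀ hb₁
  obtain ⟨A', M₂, hA', hM₂, h2142⟩ := h42 σ₁ hσ₁ le_rfl 1 one_pos le_rfl
  -- the base `L = ℓ + 1 ≥ 5`
  set Lr : ℝ := (((ℓ + 1 : ℕ) : ℝ)) with hLr
  have hL1 : 1 < Lr := by rw [hLr]; exact_mod_cast (show 1 < ℓ + 1 by omega)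
  have hL0 : 0 < Lr := lt_trans one_pos hL1
  -- choose `k = n + 2` with `A′B₃∕cR39 < Lⁿ`
  obtain ⟨n, hn⟩ := pow_unbounded_of_one_lt (A' * B₃ / cR39 b𝔸) hL1
  -- a top-empty member of nominal index `k`, with `M` above `M₁`, `M₂` and the floor
  obtain ⟨i, hik, hM, -, htop, ⟨z, hz, hlev⟩, -⟩ :=
    Node00.kRIdx_nonvacuous_oddL d ℓ (n + 2) hd hL hℓ (by omega) (max M₁ (max M₂ (Mstar : ℝ))) 0 hb₀ hb₁
  have hMi : (kGeoU i.1).M = ((ℓ + 1 : ℕ) : ℝ) * (i.1.Mh : ℝ) := rfl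
  have hMstar : Mstar ≤ (ℓ + 1) * i.1.Mh := by
    have h : (Mstar : ℝ) ≤ ((ℓ + 1 : ℕ) : ℝ) * (i.1.Mh : ℝ) := hMi ▸ le_trans (le_max_right _ _) (le_trans (le_max_right _ _) hM)
    exact_mod_cast h
  have hM₂i : M₂ ≤ ((ℓ : ℝ) + 1) * (i.1.Mh : ℝ) := by
    have h : M₂ ≤ ((ℓ + 1 : ℕ) : ℝ) * (i.1.Mh : ℝ) := hMi ▸ le_trans (le_max_left _ _) (le_trans (le_max_right _ _) hM)
    push_cast at h
    exact h
  set x : MemberY d ℓ hd hL b₀ b₁ Mstar := MemberY.diag i.1 i.2 hMstar with hxdef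
  -- an index bond at level `k − 1 = n + 1`
  set x₀ : Site (PV d ℓ i.1.m i.1.K hd hL) 0 := (boxEquiv i.1.hN).symm ⟨z, hz⟩ with hx₀def
  have hx₀ : (toBox i.1.hN x₀ : Fin (d + 1) → ℤ) = z := by
    have := (boxEquiv i.1.hN).apply_symm_apply ⟨z, hz⟩
    rw [boxEquiv_apply] at this
    exact congrArg Subtype.val this
  obtain ⟨bb, hbb⟩ := exists_bondIdx_lvl_eq i.1.hN i.1.D i.1.hk i.1.hk2 (fun y => by have := htop y; omega) x₀ (by rw [hx₀]; omega)
  -- the schema at `x`, `U = 1`, bond `bb`: `cR39·⟪e, EE e⟫ ≤ B₃·len(bb)⁻²`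
  have hMx : M₁ ≤ (geo9Y x).M := by
    show M₁ ≤ (kGeoU i.1).M
    exact le_trans (le_max_left _ _) hM
  letI : Fintype (B9GeoNormsKLevelV1.geo9K x.toKIdx).Site := (inferInstance : Fintype (geo9Y x).Site)
  have key := inner_EE_le_of_hasMaj_c2_one x.toKIdx b𝔸 (bg9Y 𝔸 G x) (fun U => U) (parS x) (parB x) (Gp x) (U₁ := fun _ _ => 1) rfl
    (hC1 x) (H x hMx) s bb
  -- Kantorovich + (2.142) at `bb`: `1 ≤ A′·Λ²·⟪e, EE e⟫`
  have h2142b := h2142 i.1.m i.1.K i.1.hN i.1.D i.1.hk i.1.hk2 i.1.hMha i.1.hM8 i.1.hR2 i.1.hP5 i.1.hℓ i.1.hpl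
    hM₂i i.1.hcf i.1.hw i.1.hwb bb bb
  have hdist : (B6Geom246MultiLevelTorus.geomT i.1.D).dist (β i.1.hN i.1.D i.1.hk bb) (β i.1.hN i.1.D i.1.hk bb) = 0 :=
    B9GeoLemma21KLevelV1.geo9K_dist_self i.1 bb
  rw [hdist, mul_zero, neg_zero, Real.exp_zero, mul_one] at h2142b
  have hXb : X i.1.hN i.1.D i.1.hk i.1.hcf i.1.hw bb bb ≤ A' * B6Prop27KLevelV1.wt i.1.hN i.1.D i.1.hk i.1.cf bb := by
    refine (le_abs_self _).trans (h2142b.trans (le_of_eq ?_))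
    unfold B6Prop27KLevelV1.wt; ring
  have hlow := one_le_wt_mul_inner_EE i.1.hN i.1.D i.1.hk i.1.hcf i.1.hw bb hXb
  -- the numbers: `len bb = 1∕L`, `Λ_bb² = L⁻²·(L^{d+1})^{−(n+1)}`
  have hcf : i.1.cf = Lr ^ (n + 2) := by rw [i.2, hik]
  have hlvl : lvl i.1.hN i.1.D i.1.hk bb = n + 1 := by rw [hbb, hik]; omega
  have hlenb : (geo9Y x).len bb = Lr⁻¹ := by
    show (B9GeoNormsKLevelV1.geo9K i.1).len bb = Lr⁻¹
    rw [B9GeoNormsKLevelV1.geo9K_len_kGeo, B6KLevelCensusIndexV1.len_eq, hlvl, hcf, abs_of_pos (pow_pos hL0 _), ← hLr,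
      pow_succ Lr (n + 1), div_mul_eq_div_div, div_self (pow_ne_zero _ hL0.ne'), one_div]
  have hwtv : B6Prop27KLevelV1.wt i.1.hN i.1.D i.1.hk i.1.cf bb = (Lr ^ 2)⁻¹ * ((Lr ^ (d + 1)) ^ (n + 1))⁻¹ := by
    unfold B6Prop27KLevelV1.wt
    rw [hlvl, hcf, ← hLr]
    have : Lr ^ (n + 1) / Lr ^ (n + 2) = Lr⁻¹ := by
      rw [pow_succ Lr (n + 1), div_mul_eq_div_div, div_self (pow_ne_zero _ hL0.ne'), one_div]
    rw [this, inv_pow]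
  -- rewrite the two inequalities in these numbers
  set E : ℝ := ⟪EuclideanSpace.single bb (1 : ℝ), EE (domT i.1.hN i.1.D i.1.hk) i.1.hcf i.1.hw (EuclideanSpace.single bb (1 : ℝ))⟫_ℝ with hE
  have key' : cR39 b𝔸 * E ≤ B₃ * Lr ^ 2 := by
    have h := key
    rw [show (B9GeoNormsKLevelV1.geo9K x.toKIdx).len bb = (geo9Y x).len bb from rfl, hlenb, inv_pow, inv_inv] at h
    exact h
  rw [hwtv] at hlow
  -- `A′ > 0` (else `1 ≤ 0`)
  have hA'0 : 0 < A' := by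
    rcases hA'.lt_or_eq with h | h
    · exact h
    · exfalso; rw [← h, zero_mul, zero_mul] at hlow; exact absurd hlow (by norm_num)
  have hpow1 : 0 < Lr ^ 2 := pow_pos hL0 _
  have hpow2 : 0 < (Lr ^ (d + 1)) ^ (n + 1) := pow_pos (pow_pos hL0 _) _
  -- `cR39·L^{(d+1)(n+1)} ≤ A′·B₃`
  have hmain : cR39 b𝔸 * (Lr ^ (d + 1)) ^ (n + 1) ≤ A' * B₃ := by
    -- from `1 ≤ A′ w E`: `cR39 ≤ A′ w (cR39 E) ≤ A′ w B₃ L²`, `w = L⁻² L^{−(d+1)(n+1)}`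
    have hw0 : 0 ≤ A' * ((Lr ^ 2)⁻¹ * ((Lr ^ (d + 1)) ^ (n + 1))⁻¹) := by positivity
    have h1 : cR39 b𝔸 ≤ A' * ((Lr ^ 2)⁻¹ * ((Lr ^ (d + 1)) ^ (n + 1))⁻¹) * (cR39 b𝔸 * E) := by
      have := mul_le_mul_of_nonneg_left hlow hc.le
      rw [mul_one] at this
      linarith [this]
    have h2 : A' * ((Lr ^ 2)⁻¹ * ((Lr ^ (d + 1)) ^ (n + 1))⁻¹) * (cR39 b𝔸 * E) ≤
        A' * ((Lr ^ 2)⁻¹ * ((Lr ^ (d + 1)) ^ (n + 1))⁻¹) * (B₃ * Lr ^ 2) := mul_le_mul_of_nonneg_left key' hw0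
    have h3 : A' * ((Lr ^ 2)⁻¹ * ((Lr ^ (d + 1)) ^ (n + 1))⁻¹) * (B₃ * Lr ^ 2) = A' * B₃ / (Lr ^ (d + 1)) ^ (n + 1) := by
      field_simp
    have h4 := (h1.trans h2).trans_eq h3
    rwa [le_div_iff₀ hpow2] at h4
  -- `L^{(d+1)(n+1)} ≤ A′B₃∕cR39 < Lⁿ ≤ L^{(d+1)(n+1)}`: contradiction
  have hkey : (Lr ^ (d + 1)) ^ (n + 1) ≤ A' * B₃ / cR39 b𝔸 := by
    rw [le_div_iff₀ hc]; linarith [hmain]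
  have hmono : Lr ^ n ≤ (Lr ^ (d + 1)) ^ (n + 1) := by
    rw [← pow_mul]
    exact pow_le_pow_right₀ hL1.le (by nlinarith)
  linarith

end Uniform

/-! ## §4 Hence the displayed binder `hlettersH12` (with the flat pins `hCco12`, `hblkZ12`) is FALSE for every value of its numerics -/

section Certificate

variable {𝔸 : Type} [NormedRing 𝔸] [NormedAlgebra ℂ 𝔸] [CompleteSpace 𝔸] [FiniteDimensional ℝ 𝔸] [NormOneClass 𝔸]
variable {κ : Type} [Fintype κ] [DecidableEq κ] {Mstar : ℕ}

/-- ★★★ **THE N06 CERTIFICATE's ROWS-20–21 BINDER `hlettersH12` IS UNSATISFIABLE AT THE FLAT C-PIN**: for letter records `𝔬 x` over the members' geometries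
with `blkZ = blkHK` and `C U = CcoK … U` (the certificate's `hblkZ12 ∕ hCco12` at letters whose `(QGQ*)⁻¹(1)` is [4]'s), NO numerics `M12, a12 > 0, B₃, δ₃`
make `∀ x, M12 ≤ M → ∀ α₀ > 0, Mα₀ ≤ a12 → ∀ U ∈ (3.35) ∩ (3.36), LettersH (𝔬 x) (R₀ x) (H₀ x) (hG x) B₃ δ₃ U` true — test it at `U = 1` (`reg335Y_one ∕
reg336Y_one`, `α₀ = a12∕M`) and read off the field `c2` (§3).  So every edition displaying this binder with these pins is vacuous AS TYPED; the repair is on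
the C-letters' normalisation (module docstring).
[cite: Balaban1985BackgroundPropagators, (3.132) p.422, (3.126) p.420, (3.35)–(3.36) p.396, Cor. 3.5 p.407; Balaban1984PropagatorsII, (2.35) p.228, (2.142) p.248] -/
theorem hlettersH_flat_pins_false (hℓ : 4 ≤ ℓ) (hb₀ : 0 < b₀) (hb₁ : b₀ ≤ b₁) (b𝔸 : Module.Basis κ ℝ 𝔸) (hc : 0 < cR39 b𝔸)
    (G : Subgroup 𝔸ˣ)
    (parS : ∀ x : MemberY d ℓ hd hL b₀ b₁ Mstar, SiteParY 𝔸 x.toKIdx) (parB : ∀ x : MemberY d ℓ hd hL b₀ b₁ Mstar, BondParY 𝔸 x.toKIdx)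
    (Gp : ∀ x : MemberY d ℓ hd hL b₀ b₁ Mstar, SiteOpY 𝔸 x.toKIdx)
    (hC1 : ∀ x : MemberY d ℓ hd hL b₀ b₁ Mstar,
      QGQinvY x.toKIdx (parS x) (parB x) (Gp x) (fun _ _ => 1) = liftEndY 𝔸 (onFun (EE (domT x.hN x.D x.hk) x.hcf x.hw)))
    [∀ x : MemberY d ℓ hd hL b₀ b₁ Mstar, Fintype (geo9Y x).Site] (s : Fin (d + 1) × κ × κ)
    {Xc Yc Wc : MemberY d ℓ hd hL b₀ b₁ Mstar → Type} [∀ x, Fintype (Xc x)] [∀ x, Fintype (Yc x)]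
    (𝔬 : ∀ x : MemberY d ℓ hd hL b₀ b₁ Mstar, Ops (geo9Y x) (bg9Y 𝔸 G x) (Xc x) (Yc x) (XHK κ x.toKIdx) (Wc x))
    (hblkZ : ∀ x, (𝔬 x).blkZ = blkHK (κ := κ) x.toKIdx)
    (hC : ∀ x U, (𝔬 x).C U = CcoK x.toKIdx b𝔸 (bg9Y 𝔸 G x) (fun U => U) (parS x) (parB x) (Gp x) U)
    (R₀ : MemberY d ℓ hd hL b₀ b₁ Mstar → ℝ) (H₀ : MemberY d ℓ hd hL b₀ b₁ Mstar → Prop) (hG : ∀ x, GeoOK (geo9Y x))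
    {c35 M12 a12 B₃ δ₃ : ℝ} (hc35 : 0 < c35) (ha12 : 0 < a12) :
    ¬ ∀ x : MemberY d ℓ hd hL b₀ b₁ Mstar, M12 ≤ (geo9Y x).M → ∀ α₀ : ℝ, 0 < α₀ → (geo9Y x).M * α₀ ≤ a12 →
        ∀ U : (bg9Y 𝔸 G x).Cfg, (bg9Y 𝔸 G x).Reg335 c35 α₀ U → (bg9Y 𝔸 G x).Reg336 c35 α₀ U →
          LettersH (𝔬 x) (R₀ x) (H₀ x) (hG x) B₃ δ₃ U := by
  intro H
  refine not_exists_uniform_c2_CcoK_one (Mstar := Mstar) hℓ hb₀ hb₁ b𝔸 hc G parS parB Gp hC1 R₀ H₀ (fun x => (hG x).lenle) s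
    ⟨B₃, δ₃, max M12 1, fun x hM => ?_⟩
  have hM12 : M12 ≤ (geo9Y x).M := (le_max_left _ _).trans hM
  have hMpos : 0 < (geo9Y x).M := lt_of_lt_of_le one_pos ((le_max_right _ _).trans hM)
  set α₀ : ℝ := a12 / (geo9Y x).M with hα₀
  have hα : 0 < α₀ := div_pos ha12 hMpos
  have hMα : (geo9Y x).M * α₀ ≤ a12 := by rw [hα₀, mul_div_cancel₀ _ hMpos.ne']
  have hL := (H x hM12 α₀ hα hMα _ (B9PinMembersKLevelV1.reg335Y_one (𝔸 := 𝔸) (G := G) x hc35 hα)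
    (B9PinMembersKLevelV1.reg336Y_one (𝔸 := 𝔸) (G := G) x hc35 hα)).c2
  rw [hC x] at hL
  have hZ := hblkZ x
  revert hL
  rw [hZ]
  exact id

end Certificate

end Literature.MathematicalPhysics.QuantumFieldTheory.Balaban1983to89.B9LettersHCOneObstruction

end
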